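import Literature.NumberTheory.GaloisRepresentations.LocalDualityDescent
import Literature.NumberTheory.GaloisRepresentations.LocalKummerTorsion
import Literature.NumberTheory.GaloisRepresentations.DualityLineOneLocal
import Literature.NumberTheory.GaloisRepresentations.LocalGlobalCohomologyFiniteProofs
import HarnessLib

/-!
# Local Tate duality over a non-archimedean local field of characteristic `0` (degree `1`)

For a non-archimedean local field `F` of characteristic `0`, a finite discrete `Γ_F`-module `M`
killed by `n ≠ 0`, `M^D = Hom(M, μ_n)` and an injective `ι : H²(Γ_F, μ_n) → ℤ/n`
(`exists_injective_iota_top`; the invariant map of local class field theory), **both adjoints of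
`(x, y) ↦ ι(x ∪ y) : H¹(F, M) × H¹(F, M^D) → ℤ/n` are bijective** (`localDuality_bijective`),
Serre, *Galois Cohomology*, II §5.2 Thm. 2 / Milne, *ADT*, I Cor. 2.3 (`r = 1`).  Assembly:

* `dualityPairing_injective_of_isPrimaryTorsion` — left injectivity for `p`-primary `M`: over the
  fixed field `E` of the preimage of a Sylow `p`-subgroup of the image of `Γ_F`
  (`exists_subgroup_index_coprime_isPGroup`) the dévissage engine
  (`dualityPairing_injective_of_devissage`, inputs `dualityPairing_injective_line`,
  `zeroTwo_eq_zero_galFixing`, `exists_injective_iota`) gives left injectivity, which descends to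
  `F` (`dualityPairing_injective_of_galFixing`, `p ∤ [E:F]`);
* `dualityPairing_injective_local` — general `M`: a `p`-primary element of the left kernel maps to
  the left kernel of `M[p^∞]` under the equivariant projection `m ↦ e m` (`e ≡ 1 (p^w)`,
  `e ≡ 0 (n/p^w)`), hence vanishes; an element of the left kernel of composite order would have a
  nonzero primary multiple in the kernel;
* `localDuality_bijective` — with `M^D` in place of `M` and the finiteness of `H¹`
  (`finite_galoisCohomology_one_of_isNonarchimedeanLocalField`), counting
  (`dualityPairing_bijective_of_injective`).

## References
* J.-P. Serre, *Galois Cohomology*, Springer, 1997, II §5.2 Thm. 2. [SerreGaloisCohomology1997]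
* J. S. Milne, *Arithmetic Duality Theorems*, 2006, I Cor. 2.3. [MilneADT2006]
-/

noncomputable section

open CategoryTheory Function
open Field IsNonarchimedeanLocalField ValuativeRel IntermediateField

universe u

namespace Literature.NumberTheory.GaloisRepresentations

open _root_.TopRep _root_.ContRepresentation _root_.ContinuousCohomology DiscreteGaloisModule
open LocalWeilDatum

/-! ### Multiplication by `e` on `H¹` and the projection to `M[q]` -/

section Projection

variable {G : Type u} [Group G] [TopologicalSpace G] [IsTopologicalGroup G]
variable {M : Type u} [AddCommGroup M] [TopologicalSpace M] [DiscreteTopology M]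
variable (ρ : ContinuousRep G ℤ M)

/-- `H¹(f) = e` on `H¹(G, M)` for a morphism `f : M → M` with `f(m) = e m`. [folklore] -/
theorem cohomologyMap_one_eq_nsmul (f : ρ.toTopRep ⟶ ρ.toTopRep) (e : ℕ) (hf : ∀ m : M, f.hom m = e • m)
    (a : continuousCohomology 1 ρ.toTopRep) : cohomologyMap f 1 a = e • a := by
  obtain ⟨c, rfl⟩ := oneCocycleClass_surjective _ a
  rw [cohomologyMap_oneCocycleClass]
  have hc : contOneCocycles.pullback (ContinuousMonoidHom.id G) (resIdHom f) c = (e : ℤ) • c :=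
    Subtype.ext (ContinuousMap.ext fun g => by
      rw [pullback_id_resIdHom_apply, hf]
      change e • c.1 g = ((e : ℤ) • c.1) g
      rw [ContinuousMap.smul_apply, natCast_zsmul])
  rw [hc, oneCocycleClass_smul, Nat.cast_smul_eq_nsmul]

variable {n : ℕ} (hM : ∀ m : M, n • m = 0) (q e : ℕ) (hqn : q ∣ n) (he : n / q ∣ e)

omit [TopologicalSpace M] [DiscreteTopology M] in
include hM hqn he in
/-- `q (e m) = 0` when `q ∣ n`, `n/q ∣ e`, `n M = 0`. [folklore] -/
theorem nsmul_nsmul_eq_zero_of_dvd (m : M) : q • e • m = 0 := by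
  obtain ⟨t, rfl⟩ := he
  obtain ⟨s, hs⟩ := hqn
  have hq : q * (n / q * t) = t * n := by
    rcases Nat.eq_zero_or_pos q with rfl | hq0
    · simp [hs]
    · rw [← mul_assoc, Nat.mul_div_cancel' ⟨s, hs⟩, mul_comm]
  rw [← mul_nsmul', hq, mul_nsmul', hM, nsmul_zero]

/-- **The equivariant projection `m ↦ e m : M → M[q]`** (`q ∣ n`, `n/q ∣ e`, `n M = 0`). [folklore] -/
def torsionProj : ρ.toTopRep ⟶ (ρ.torsionRep q).toTopRep :=
  TopRep.ofHom
    { toLinearMap :=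
        { toFun := fun m => ⟨e • m, (ContinuousRep.mem_torsionBy_nsmul_iff q).2
            (nsmul_nsmul_eq_zero_of_dvd hM q e hqn he m)⟩
          map_add' := fun m m' => Subtype.ext (nsmul_add m m' e)
          map_smul' := fun c m => Subtype.ext (by
            change e • (c • m) = c • (e • m)
            exact smul_comm e c m) }
      cont := continuous_of_discreteTopology
      isIntertwining' := fun g => by
        refine ContinuousLinearMap.ext fun m => Subtype.ext ?_
        change e • ρ.toTopRep.ρ g m = ρ g (e • m)
        rw [ContinuousRep.toTopRep_ρ_apply, map_nsmul] }

omit [IsTopologicalGroup G] in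
/-- `torsionProj` on elements. [folklore] -/
@[simp] theorem torsionProj_hom_apply_coe (m : M) :
    (((torsionProj ρ hM q e hqn he).hom m : Submodule.torsionBy ℤ M (q : ℤ)) : M) = e • m := rfl

end Projection

/-! ### The local field -/

section Local

variable (F : Type u) [Field F] [ValuativeRel F] [TopologicalSpace F] [IsNonarchimedeanLocalField F]
  [CharZero F]
variable {M : Type u} [AddCommGroup M] [TopologicalSpace M] [DiscreteTopology M] [Finite M]

attribute [local instance] compactSpace_of_isClosed_subgroup isClosed_galFixing' finite_quot_galFixing Fintype.ofFinite

omit [ValuativeRel F] [TopologicalSpace F] [IsNonarchimedeanLocalField F] in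
/-- `μ_n(F̄)` is finite (of order `n`). [folklore] -/
theorem finite_muCarrier (n : ℕ) [NeZero n] : Finite (MuCarrier F n) := by
  haveI : NeZero (n : F) := ⟨Nat.cast_ne_zero.2 (NeZero.ne n)⟩
  have hc : Nat.card (MuCarrier F n) = n := by
    change Nat.card (rootsOfUnity n (AlgebraicClosure F)) = n
    exact HasEnoughRootsOfUnity.natCard_rootsOfUnity _ n
  exact Nat.finite_of_card_ne_zero (by rw [hc]; exact NeZero.ne n)

attribute [local instance] finite_muCarrier

/-- **Left injectivity for `p`-primary `M`**: engine over `E` (Sylow) and descent.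
[cite: SerreGaloisCohomology1997, II §5.2 Thm. 2] -/
theorem dualityPairing_injective_of_isPrimaryTorsion (ρ : ContinuousRep (absoluteGaloisGroup F) ℤ M) {p : ℕ}
    [hp : Fact p.Prime] (hpM : IsPrimaryTorsion p M) {n : ℕ} [NeZero n] (hM : ∀ m : M, n • m = 0)
    (ιF : continuousCohomology 2 (mu F n).toTopRep →+ ZMod n) (hιF : Injective ιF) :
    Injective (ρ.dualityPairing (mu F n) ιF) := by
  classical
  by_cases hsub : Subsingleton M
  · haveI := subsingleton_continuousCohomology_of_subsingleton ρ.toTopRep 0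
    exact fun a b _ => Subsingleton.elim a b
  haveI : Nontrivial M := not_subsingleton_iff_nontrivial.1 hsub
  have hpn : p ∣ n := by
    by_contra hpn
    obtain ⟨m, hm⟩ := exists_ne (0 : M)
    obtain ⟨r, hr⟩ := hpM m
    exact hm (eq_zero_of_nsmul_of_pow_nsmul hp.out hpn (hM m) hr)
  obtain ⟨S', hopen, hidx, N₀, hN₀, hfin, hP, htriv⟩ := exists_subgroup_index_coprime_isPGroup ρ p
  obtain ⟨E, hEfin, hE⟩ := exists_galFixing_eq_of_isOpen S' hopen
  subst hE
  haveI := hEfin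
  haveI := hN₀
  haveI := hfin
  obtain ⟨ιE, hιE⟩ := exists_injective_iota F E n
  have hEinj := dualityPairing_injective_of_devissage
    ((mu F n).restrict (subgroupIncl (galFixing F E))) (muEquivZMod F n) ιE hpn N₀ hP
    (fun W _ _ _ _ τ hτ hW => dualityPairing_injective_line F E hpn ιE hιE τ hτ hW)
    (fun W _ _ _ _ τ hτ hW z hz => zeroTwo_eq_zero_galFixing F E hpn ιE hιE τ hτ hW z hz)
    M (ρ.restrict (subgroupIncl (galFixing F E))) hpM hM (fun g hg m => htriv g hg m)
  obtain ⟨k, hk⟩ := exists_pow_nsmul_eq_zero_of_isPrimaryTorsion hpM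
  exact dualityPairing_injective_of_galFixing F E hidx ιF hιF ιE ρ hk hEinj

/-- **Left injectivity of `H¹(F, M) × H¹(F, M^D) → ℤ/n` for every finite `M` killed by `n`.**
[cite: SerreGaloisCohomology1997, II §5.2 Thm. 2; MilneADT2006, I Cor. 2.3] -/
theorem dualityPairing_injective_local (ρ : ContinuousRep (absoluteGaloisGroup F) ℤ M) {n : ℕ} [NeZero n]
    (hM : ∀ m : M, n • m = 0) (ιF : continuousCohomology 2 (mu F n).toTopRep →+ ZMod n) (hιF : Injective ιF) :
    Injective (ρ.dualityPairing (mu F n) ιF) := by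
  classical
  -- Step 1: `p`-primary elements of the left kernel vanish
  have hprim : ∀ p : ℕ, p.Prime → ∀ a : continuousCohomology 1 ρ.toTopRep,
      ρ.dualityPairing (mu F n) ιF a = 0 → p ^ n.factorization p • a = 0 → a = 0 := by
    intro p hp a ha hpa
    haveI : Fact p.Prime := ⟨hp⟩
    have hqn : p ^ n.factorization p ∣ n := Nat.ordProj_dvd n p
    have hcop : Nat.Coprime (p ^ n.factorization p) (n / p ^ n.factorization p) :=
      (Nat.coprime_ordCompl hp (NeZero.ne n)).pow_left _
    obtain ⟨e, he1, he0⟩ := Nat.chineseRemainder hcop 1 0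
    have he : n / p ^ n.factorization p ∣ e := Nat.modEq_zero_iff_dvd.1 he0
    let π := torsionProj ρ hM (p ^ n.factorization p) e hqn he
    -- `H¹(π) a` lies in the left kernel of `M[p^w]`
    have hker : (ρ.torsionRep (p ^ n.factorization p)).dualityPairing (mu F n) ιF (cohomologyMap π 1 a) = 0 := by
      refine AddMonoidHom.ext fun b => ?_
      rw [ContinuousRep.dualityPairing_apply, AddMonoidHom.zero_apply,
        ContPairing.cupProduct_adjoint (ρ.evalPairing (mu F n))
          ((ρ.torsionRep (p ^ n.factorization p)).evalPairing (mu F n)) π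
          (ContinuousRep.homRepMap (mu F n) π) (fun _ _ => rfl) a b]
      exact congrArg (fun φ : _ →+ ZMod n => φ (cohomologyMap (ContinuousRep.homRepMap (mu F n) π) 1 b)) ha
    have hprimT : IsPrimaryTorsion p (Submodule.torsionBy ℤ M ((p ^ n.factorization p : ℕ) : ℤ)) := fun x =>
      ⟨n.factorization p, Subtype.ext ((ContinuousRep.mem_torsionBy_nsmul_iff (p ^ n.factorization p)).1 x.2)⟩
    have hMT : ∀ x : Submodule.torsionBy ℤ M ((p ^ n.factorization p : ℕ) : ℤ), n • x = 0 := fun x =>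
      Subtype.ext (hM x)
    have hinjT := dualityPairing_injective_of_isPrimaryTorsion F (ρ.torsionRep (p ^ n.factorization p))
      hprimT hMT ιF hιF
    have h0 : cohomologyMap π 1 a = 0 := (injective_iff_map_eq_zero _).1 hinjT _ hker
    -- `a = e a = H¹(incl) (H¹(π) a) = 0`
    have hcomp : cohomologyMap (ρ.torsionIncl (p ^ n.factorization p)) 1 (cohomologyMap π 1 a) =
        cohomologyMap (π ≫ ρ.torsionIncl (p ^ n.factorization p)) 1 a :=
      (map_comp_apply_of (ContinuousMonoidHom.id _) (ContinuousMonoidHom.id _) (ContinuousMonoidHom.id _)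
        (fun _ => rfl) (resIdHom π) (resIdHom (ρ.torsionIncl (p ^ n.factorization p)))
        (resIdHom (π ≫ ρ.torsionIncl (p ^ n.factorization p))) (fun _ => rfl) 1 a).symm
    have hea : cohomologyMap (π ≫ ρ.torsionIncl (p ^ n.factorization p)) 1 a = e • a :=
      cohomologyMap_one_eq_nsmul ρ _ e (fun _ => rfl) a
    have hea' : e • a = a := by
      have h1 : e % p ^ n.factorization p = 1 % p ^ n.factorization p := he1
      rw [← ContinuousRep.mod_nsmul_eq hpa e, h1, ContinuousRep.mod_nsmul_eq hpa 1, one_nsmul]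
    rw [← hea', ← hea, ← hcomp, h0, map_zero]
  -- Step 2: an element of the left kernel of composite order has a nonzero primary multiple in it
  refine (injective_iff_map_eq_zero _).2 fun a ha => ?_
  by_contra hane
  have hna : n • a = 0 := nsmul_continuousCohomology_one_eq_zero _ _ hM a
  have ho : 0 < addOrderOf a :=
    addOrderOf_pos_iff.2 (isOfFinAddOrder_iff_nsmul_eq_zero.2 ⟨n, NeZero.pos n, hna⟩)
  have ho1 : addOrderOf a ≠ 1 := fun h => hane (AddMonoid.addOrderOf_eq_one_iff.1 h)
  obtain ⟨o, hodef⟩ : ∃ o : ℕ, o = addOrderOf a := ⟨_, rfl⟩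
  rw [← hodef] at ho ho1
  have hp : o.minFac.Prime := Nat.minFac_prime ho1
  have hpo : o.minFac ∣ o := Nat.minFac_dvd o
  have hon : o ∣ n := by rw [hodef]; exact addOrderOf_dvd_iff_nsmul_eq_zero.2 hna
  -- `a' = (o / p^v) • a` is `p`-primary and in the left kernel
  have ha' : ρ.dualityPairing (mu F n) ιF ((o / o.minFac ^ o.factorization o.minFac) • a) = 0 := by
    rw [map_nsmul, ha, nsmul_zero]
  have hpa' : o.minFac ^ n.factorization o.minFac • (o / o.minFac ^ o.factorization o.minFac) • a = 0 := by
    have hle : o.factorization o.minFac ≤ n.factorization o.minFac :=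
      (Nat.factorization_le_iff_dvd ho.ne' (NeZero.ne n)).2 hon o.minFac
    obtain ⟨j, hj⟩ := Nat.exists_eq_add_of_le hle
    rw [hj, pow_add, mul_nsmul, ← mul_nsmul' a, Nat.ordProj_mul_ordCompl_eq_self, hodef, addOrderOf_nsmul_eq_zero,
      nsmul_zero]
  have hzero := hprim o.minFac hp _ ha' hpa'
  -- hence `o ∣ o / p^v < o`, absurd
  have hdvd : o ∣ o / o.minFac ^ o.factorization o.minFac := by
    have h3 := addOrderOf_dvd_iff_nsmul_eq_zero.2 hzero
    rwa [← hodef] at h3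
  have ho'pos : 0 < o / o.minFac ^ o.factorization o.minFac := Nat.ordCompl_pos o.minFac ho.ne'
  have hv : o.factorization o.minFac ≠ 0 := (hp.factorization_pos_of_dvd ho.ne' hpo).ne'
  have hlt : o / o.minFac ^ o.factorization o.minFac < o :=
    calc o / o.minFac ^ o.factorization o.minFac
        < o.minFac ^ o.factorization o.minFac * (o / o.minFac ^ o.factorization o.minFac) :=
          lt_mul_left ho'pos (Nat.one_lt_pow hv hp.one_lt)
      _ = o := Nat.ordProj_mul_ordCompl_eq_self o o.minFac
  exact absurd (Nat.le_of_dvd ho'pos hdvd) (not_le.2 hlt)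

/-- **Local Tate duality in degree `1`** over a non-archimedean local field `F` of characteristic
`0`: for a finite discrete `Γ_F`-module `M` killed by `n ≠ 0` there is an injective
`ι : H²(Γ_F, μ_n) → ℤ/n` such that both adjoints of `(x, y) ↦ ι(x ∪ y) : H¹(F, M) × H¹(F, M^D) → ℤ/n`
(`M^D = Hom(M, μ_n)`) are bijective. [cite: SerreGaloisCohomology1997, II §5.2 Thm. 2; MilneADT2006, I Cor. 2.3] -/
theorem localDuality_bijective (ρ : ContinuousRep (absoluteGaloisGroup F) ℤ M) {n : ℕ} [NeZero n]
    (hM : ∀ m : M, n • m = 0) :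
    ∃ ι : continuousCohomology 2 (mu F n).toTopRep →+ ZMod n, Injective ι ∧
      Bijective (ρ.dualityPairing (mu F n) ι) ∧ Bijective (ρ.dualityPairing (mu F n) ι).flip := by
  obtain ⟨ι, hι⟩ := exists_injective_iota_top F n
  have hD : ∀ f : HomCarrier M (MuCarrier F n), n • f = 0 := fun f => HomCarrier.nsmul_eq_zero_of_left hM f
  have h₁ := dualityPairing_injective_local F ρ hM ι hι
  have h₂ := dualityPairing_injective_local F (ρ.homRep (mu F n)) hD ι hι
  haveI : Finite (continuousCohomology 1 ρ.toTopRep) :=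
    finite_galoisCohomology_one_of_isNonarchimedeanLocalField ρ
  haveI : Finite (continuousCohomology 1 (ρ.homRep (mu F n)).toTopRep) :=
    finite_galoisCohomology_one_of_isNonarchimedeanLocalField (ρ.homRep (mu F n))
  exact ⟨ι, hι, ContinuousRep.dualityPairing_bijective_of_injective ρ (mu F n) (muEquivZMod F n) ι hM h₁ h₂⟩

end Local

end Literature.NumberTheory.GaloisRepresentations

end
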